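import Literature.InformationTheory.QuantumCodes.TwistedToricDistance
import HarnessLib

/-!
# Toric codes on twisted tori — the rotated families: `[[d²+1, 2, d]]` (cyclic) and `[[2n²c, 2, n(2t+1)]]` (KP13 Ex. 7)

Topic `InformationTheory/QuantumCodes`; namespace `Literature.InformationTheory.QuantumCodes.TwistedToric`.
LADDER-QEC (cell `qec`), PARTITION row 08, item 08.TWIST (family instances of `code_isCode_of_gen`,
`TwistedToricDistance.lean`).

The lattice `Λ_t = ⟨(t, t+1), (t+1, −t)⟩ ⊂ ℤ²` (`|ℤ²/Λ_t| = c = t² + (t+1)²`, L¹-systole `2t+1`) is the period lattice of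
Kovalev–Pryadko's odd-distance rotated toric codes: ISIT 2012 Ex. 1 (`L₁ = (2t+1,1)`, `L₂ = (−1,2t+1)` in checkerboard
coordinates, `[[1+(2t+1)², 2, 2t+1]]`) = PRA 88 Ex. 2 (cyclic GB form, `[[2t²+2(t+1)², 2, 2t+1]]`); its `n`-fold dilate
`nΛ_t` gives PRA 88 Ex. 7 (`[[2n²c, 2, nχ]]`, `χ = 2t+1`: `[[40,2,6]]`, `[[90,2,9]]`, `[[104,2,10]]`, `[[234,2,15]]`, …). In
two-block vocabulary (an integer `a` with `(t+1)a ≡ t`, `ta ≡ −(t+1) (mod c)`, e.g. `a = t(t+1)⁻¹`):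

* `rotated_core` — the arithmetic heart: if `c ∣ a m₁ + m₂` and `|m₁| + |m₂| ≤ 2t` then `m = 0` (both
  `t m₁ + (t+1) m₂` and `(t+1) m₁ − t m₂` are multiples of `c` of absolute value `≤ (t+1)·2t < c`).
* **`rotated_isCode`** — `G = ℤ_c`, `g₁ = a`, `g₂ = 1`: `LP[1 + x^a, 1 + x]` is `[[2c, 2, 2t+1]] = [[d²+1, 2, d]]` for EVERY
  `t` (`d = 2t+1`; the parameters attaining Bombin–Martin-Delgado's bound `n ≥ d²+1` for square-lattice toric codes of
  odd distance); instances `t = 1,2,3`: `[[10,2,3]]`, `[[26,2,5]]`, `[[50,2,7]]`.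
* **`dilated_isCode`** — `G = ℤ_n × ℤ_{nc}`, `g₁ = (1, a)`, `g₂ = (0, 1)` (period lattice `nΛ_t`): `[[2n²c, 2, n(2t+1)]]`
  for EVERY `n ≥ 1` and `t` — Kovalev–Pryadko 2013 Example 7's printed formula «[[2n²c, 2, nχ]] by construction» as a
  theorem; instances `(n,t) = (2,1), (3,1), (2,2), (3,2)`: `[[40,2,6]]`, `[[90,2,9]]`, `[[104,2,10]]`, `[[234,2,15]]` (the
  `(2,2)` presentation is literally qec-lit-3's identification of census row HB104; `(2,1)`, `(3,1)` agree with lit-3's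
  HB40 / HB90a presentations up to the automorphism `y ↦ −y` of the second factor — lit/TWIST-LOCATORS.md §4).

0 named facts, no instances (typeclass), no notation; axioms standard; `decide` only on numerals.

## References
* [KovalevPryadko2012] arXiv:1202.0928 §III.C Ex. 1 (p0005 L79-84: «[[1+(2t+1)², 2, 2t+1]]; explicitly: [[10,2,3]] …,
  [[26,2,5]], [[50,2,7]]»).
* [KovalevPryadko2013Hyperbicycle] arXiv:1212.6703 §III.B Ex. 2 (p0008 L11-15) and §IV Ex. 7 (p0016 L18-24: «c = t²+(t+1)²,
  χ = 2t+1 … codes with parameters [[2n²c, 2, nχ]]. Explicitly for n=2 we obtain [[40,2,6]], [[104,2,10]] …, and for n=3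
  [[90,2,9]], [[234,2,15]] …»).
* [BombinMartinDelgado2007] arXiv:quant-ph/0605094, App. (chunk p0024 L1-45: n ≥ d²+1 for (4,4) toric codes of odd d).
-/

namespace Literature.InformationTheory.QuantumCodes

open Matrix Finset

namespace TwistedToric

/-! ## The arithmetic core -/

section Core

/-- **Core lemma of the rotated lattice `Λ_t`**: with `c = t² + (t+1)²` and `a` satisfying `(t+1)a ≡ t`,
`ta ≡ −(t+1) (mod c)`, an integer vector `m` with `c ∣ a m₁ + m₂` and `|m₁| + |m₂| ≤ 2t` is zero.
[cite: KovalevPryadko2012, §III.C Ex. 1 (p0005 L79-84: the lattice of L₁ = (2t+1,1), L₂ = (−1,2t+1) has distance 2t+1)] -/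
theorem rotated_core (t : ℕ) {c : ℤ} (hc : c = (t : ℤ) ^ 2 + ((t : ℤ) + 1) ^ 2) {a : ℤ}
    (ha : c ∣ ((t : ℤ) + 1) * a - t) (ha' : c ∣ (t : ℤ) * a + (t + 1)) {m : ℤ × ℤ} (hm : c ∣ a * m.1 + m.2)
    (hl : l1 m ≤ 2 * t) : m = 0 := by
  have hA : c ∣ (t : ℤ) * m.1 + ((t : ℤ) + 1) * m.2 := by
    have h := (hm.mul_left ((t : ℤ) + 1)).sub (ha.mul_right m.1)
    have e : ((t : ℤ) + 1) * (a * m.1 + m.2) - (((t : ℤ) + 1) * a - t) * m.1 = (t : ℤ) * m.1 + ((t : ℤ) + 1) * m.2 := by ring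
    rwa [e] at h
  have hB : c ∣ ((t : ℤ) + 1) * m.1 - (t : ℤ) * m.2 := by
    have h := (ha'.mul_right m.1).sub (hm.mul_left (t : ℤ))
    have e : ((t : ℤ) * a + (t + 1)) * m.1 - (t : ℤ) * (a * m.1 + m.2) = ((t : ℤ) + 1) * m.1 - (t : ℤ) * m.2 := by ring
    rwa [e] at h
  have hl' : m.1.natAbs + m.2.natAbs ≤ 2 * t := hl
  have hcn : c.natAbs = t ^ 2 + (t + 1) ^ 2 := by
    have e : ((t : ℤ) ^ 2 + ((t : ℤ) + 1) ^ 2) = ((t ^ 2 + (t + 1) ^ 2 : ℕ) : ℤ) := by push_cast; ring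
    rw [hc, e, Int.natAbs_natCast]
  have hlt_c : (t + 1) * (2 * t) < c.natAbs := by rw [hcn]; nlinarith
  have e1 : ((t : ℤ)).natAbs = t := by simp
  have e2 : ((t : ℤ) + 1).natAbs = t + 1 := by omega
  have hAlt : ((t : ℤ) * m.1 + ((t : ℤ) + 1) * m.2).natAbs < c.natAbs := by
    have h1 := Int.natAbs_add_le ((t : ℤ) * m.1) (((t : ℤ) + 1) * m.2)
    rw [Int.natAbs_mul, Int.natAbs_mul, e1, e2] at h1
    have h2 : t * m.1.natAbs ≤ (t + 1) * m.1.natAbs := Nat.mul_le_mul_right _ (Nat.le_succ t)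
    have h3 := Nat.mul_le_mul_left (t + 1) hl'
    nlinarith
  have hBlt : (((t : ℤ) + 1) * m.1 - (t : ℤ) * m.2).natAbs < c.natAbs := by
    have h1 := Int.natAbs_sub_le (((t : ℤ) + 1) * m.1) ((t : ℤ) * m.2)
    rw [Int.natAbs_mul, Int.natAbs_mul, e1, e2] at h1
    have h2 : t * m.2.natAbs ≤ (t + 1) * m.2.natAbs := Nat.mul_le_mul_right _ (Nat.le_succ t)
    have h3 := Nat.mul_le_mul_left (t + 1) hl'
    nlinarith
  have hA0 := Int.eq_zero_of_dvd_of_natAbs_lt_natAbs hA hAlt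
  have hB0 := Int.eq_zero_of_dvd_of_natAbs_lt_natAbs hB hBlt
  have hcpos : 0 < c := by rw [hc]; positivity
  have hm1 : c * m.1 = 0 := by rw [hc]; linear_combination (t : ℤ) * hA0 + ((t : ℤ) + 1) * hB0
  have hm2 : c * m.2 = 0 := by rw [hc]; linear_combination ((t : ℤ) + 1) * hA0 - (t : ℤ) * hB0
  ext
  · exact (mul_eq_zero.1 hm1).resolve_left hcpos.ne'
  · exact (mul_eq_zero.1 hm2).resolve_left hcpos.ne'

end Core

/-! ## The cyclic family `[[2c, 2, 2t+1]]` -/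

section Cyclic

variable {c : ℕ} [NeZero c] {t : ℕ} {a : ℤ}

/-- In `ℤ_c` the element `1` generates: `g₂ = 1`. [cite: KovalevPryadko2013Hyperbicycle, §III.B Ex. 2 (p0008 L11-15: cyclic presentation)] -/
theorem gen_one (α : ZMod c) : ∀ x : ZMod c, ∃ m : ℤ × ℤ, m.1 • α + m.2 • (1 : ZMod c) = x :=
  fun x => ⟨(0, (x.val : ℤ)), by simp⟩

omit [NeZero c] in
/-- Periods of `(ℤ_c; a, 1)` are the `m` with `c ∣ a m₁ + m₂`. [cite: KovalevPryadko2012, §III.C (p0005 L53-60: the period lattice)] -/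
theorem isPeriod_cyclic_iff (m : ℤ × ℤ) : IsPeriod (a : ZMod c) (1 : ZMod c) m ↔ (c : ℤ) ∣ a * m.1 + m.2 := by
  rw [IsPeriod, ← ZMod.intCast_zmod_eq_zero_iff_dvd]
  simp only [zsmul_eq_mul, mul_one, Int.cast_add, Int.cast_mul]
  rw [mul_comm]

/-- **`sys₁ = 2t+1` for the cyclic rotated lattice.** [cite: KovalevPryadko2012, §III.C Ex. 1 (p0005 L79-84: distance 2t+1)] -/
theorem systole_cyclic (hc : (c : ℤ) = (t : ℤ) ^ 2 + ((t : ℤ) + 1) ^ 2) (ha : (c : ℤ) ∣ ((t : ℤ) + 1) * a - t)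
    (ha' : (c : ℤ) ∣ (t : ℤ) * a + (t + 1)) : systole (a : ZMod c) (1 : ZMod c) = 2 * t + 1 := by
  have hper : IsPeriod (a : ZMod c) (1 : ZMod c) (((t : ℤ) + 1), -(t : ℤ)) := by
    rw [isPeriod_cyclic_iff]
    have e : a * ((t : ℤ) + 1) + -(t : ℤ) = ((t : ℤ) + 1) * a - t := by ring
    rw [e]; exact ha
  refine le_antisymm ?_ ?_
  · have h := systole_le hper (by simp [Prod.ext_iff]; omega)
    have e : l1 (((t : ℤ) + 1), -(t : ℤ)) = 2 * t + 1 := by simp [l1]; omega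
    rwa [e] at h
  · obtain ⟨m, hm, h0, hl⟩ := systole_spec (a : ZMod c) (1 : ZMod c)
    rw [← hl]
    by_contra hlt
    exact h0 (rotated_core t hc ha ha' ((isPeriod_cyclic_iff m).1 hm) (by omega))

/-- **The cyclic rotated family**: for every `t` and `c = t² + (t+1)²`, `a` with `(t+1)a ≡ t`, `ta ≡ −(t+1) (mod c)`,
the twisted toric code `LP[1 + x^a, 1 + x]` over `ℤ_c` is `[[2c, 2, 2t+1]]` (`= [[d²+1, 2, d]]`, `d = 2t+1`).
[cite: KovalevPryadko2013Hyperbicycle, §III.B Ex. 2 (p0008 L11-15: «[[2t²+2(t+1)², 2, 2t+1]]»)] [cite: KovalevPryadko2012, §III.C Ex. 1 (p0005 L79-84: «[[1+(2t+1)², 2, 2t+1]]»)] -/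
theorem rotated_isCode (hc : (c : ℤ) = (t : ℤ) ^ 2 + ((t : ℤ) + 1) ^ 2) (ha : (c : ℤ) ∣ ((t : ℤ) + 1) * a - t)
    (ha' : (c : ℤ) ∣ (t : ℤ) * a + (t + 1)) : (code (a : ZMod c) (1 : ZMod c)).IsCode (2 * c) 2 (2 * t + 1) := by
  have h := code_isCode_of_gen (gen_one (a : ZMod c))
  rwa [systole_cyclic hc ha ha', ZMod.card] at h

/-- `t = 1`: `[[10, 2, 3]]` — `LP[1 + x³, 1 + x]` over `ℤ₅`. [cite: KovalevPryadko2013Hyperbicycle, §III.B Ex. 2 (p0008 L11-15: [[10,2,3]])] -/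
theorem rotated_isCode_t1 : (code (3 : ZMod 5) 1).IsCode 10 2 3 := by
  have h := rotated_isCode (c := 5) (t := 1) (a := 3) (by norm_num) (by decide) (by decide)
  simpa using h

/-- `t = 2`: `[[26, 2, 5]]` — `LP[1 + x⁵, 1 + x]` over `ℤ₁₃`. [cite: KovalevPryadko2013Hyperbicycle, §III.B Ex. 2 (p0008 L11-15: [[26,2,5]])] -/
theorem rotated_isCode_t2 : (code (5 : ZMod 13) 1).IsCode 26 2 5 := by
  have h := rotated_isCode (c := 13) (t := 2) (a := 5) (by norm_num) (by decide) (by decide)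
  simpa using h

/-- `t = 3`: `[[50, 2, 7]]` — `LP[1 + x⁷, 1 + x]` over `ℤ₂₅`. [cite: KovalevPryadko2012, §III.C Ex. 1 (p0005 L79-84: [[50,2,7]])] -/
theorem rotated_isCode_t3 : (code (7 : ZMod 25) 1).IsCode 50 2 7 := by
  have h := rotated_isCode (c := 25) (t := 3) (a := 7) (by norm_num) (by decide) (by decide)
  simpa using h

end Cyclic

/-! ## The dilated family `[[2n²c, 2, n(2t+1)]]` (Kovalev–Pryadko 2013 Example 7) -/

section Dilated

variable {n N : ℕ} [NeZero n] [NeZero N] {c t : ℕ} {a : ℤ}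

/-- `(1, a)` and `(0, 1)` generate `ℤ_n × ℤ_N`. [cite: KovalevPryadko2013Hyperbicycle, §IV Ex. 7 (p0016 L18-24)] -/
theorem gen_dilated (a : ℤ) :
    ∀ x : ZMod n × ZMod N, ∃ m : ℤ × ℤ, m.1 • ((1 : ZMod n), (a : ZMod N)) + m.2 • ((0 : ZMod n), (1 : ZMod N)) = x := by
  intro x
  refine ⟨((x.1.val : ℤ), (x.2.val : ℤ) - a * x.1.val), ?_⟩
  ext
  · simp
  · simp; ring

omit [NeZero n] [NeZero N] in
/-- Periods of `(ℤ_n × ℤ_N; (1,a), (0,1))` are the `m` with `n ∣ m₁` and `N ∣ a m₁ + m₂`.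
[cite: KovalevPryadko2012, §III.C (p0005 L53-60: the period lattice)] -/
theorem isPeriod_dilated_iff (m : ℤ × ℤ) :
    IsPeriod ((1 : ZMod n), (a : ZMod N)) ((0 : ZMod n), (1 : ZMod N)) m ↔ (n : ℤ) ∣ m.1 ∧ (N : ℤ) ∣ a * m.1 + m.2 := by
  rw [IsPeriod, ← ZMod.intCast_zmod_eq_zero_iff_dvd, ← ZMod.intCast_zmod_eq_zero_iff_dvd]
  simp only [Prod.smul_mk, zsmul_eq_mul, mul_one, mul_zero, Prod.mk_add_mk, add_zero, Prod.mk_eq_zero, Int.cast_add,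
    Int.cast_mul]
  rw [mul_comm (m.1 : ZMod N)]

/-- **`sys₁(nΛ_t) = n(2t+1)`**: with `N = nc`, `c = t² + (t+1)²`, `(t+1)a ≡ t`, `ta ≡ −(t+1) (mod c)`, the period
lattice of `(ℤ_n × ℤ_N; (1,a), (0,1))` is `nΛ_t` and has L¹ systole `n(2t+1)`.
[cite: KovalevPryadko2013Hyperbicycle, §IV Ex. 7 (p0016 L5-24: «the Manhattan distance … will actually determine the distance of the code … χ = 2t+1 … [[2n²c, 2, nχ]]»)] -/
theorem systole_dilated (hN : N = n * c) (hc : (c : ℤ) = (t : ℤ) ^ 2 + ((t : ℤ) + 1) ^ 2)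
    (ha : (c : ℤ) ∣ ((t : ℤ) + 1) * a - t) (ha' : (c : ℤ) ∣ (t : ℤ) * a + (t + 1)) :
    systole ((1 : ZMod n), (a : ZMod N)) ((0 : ZMod n), (1 : ZMod N)) = n * (2 * t + 1) := by
  have hn0 : (n : ℤ) ≠ 0 := by exact_mod_cast NeZero.ne n
  have hper : IsPeriod ((1 : ZMod n), (a : ZMod N)) ((0 : ZMod n), (1 : ZMod N)) ((n : ℤ) * (t + 1), -((n : ℤ) * t)) := by
    rw [isPeriod_dilated_iff]
    refine ⟨⟨(t : ℤ) + 1, by ring⟩, ?_⟩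
    obtain ⟨k, hk⟩ := ha
    refine ⟨k, ?_⟩
    rw [hN]; push_cast
    linear_combination (n : ℤ) * hk
  refine le_antisymm ?_ ?_
  · have h := systole_le hper (by
      simp only [ne_eq, Prod.ext_iff, Prod.fst_zero, Prod.snd_zero, not_and]
      intro h1
      exfalso
      have : (n : ℤ) * (t + 1) ≠ 0 := mul_ne_zero hn0 (by omega)
      exact this h1)
    have e : l1 ((n : ℤ) * (t + 1), -((n : ℤ) * t)) = n * (2 * t + 1) := by
      simp only [l1, Int.natAbs_neg, Int.natAbs_mul, Int.natAbs_natCast]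
      have e2 : ((t : ℤ) + 1).natAbs = t + 1 := by omega
      rw [e2]; ring
    rwa [e] at h
  · obtain ⟨m, hm, h0, hl⟩ := systole_spec ((1 : ZMod n), (a : ZMod N)) ((0 : ZMod n), (1 : ZMod N))
    rw [← hl]
    by_contra hlt
    rw [not_le] at hlt
    obtain ⟨⟨u, hu⟩, hdiv⟩ := (isPeriod_dilated_iff m).1 hm
    -- `n ∣ m₂` as well, so `m = n • (u, v)`
    have hnN : (n : ℤ) ∣ (N : ℤ) := ⟨c, by rw [hN]; push_cast; ring⟩
    have hdiv' : (n : ℤ) ∣ a * m.1 + m.2 := hnN.trans hdiv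
    obtain ⟨v, hv⟩ : (n : ℤ) ∣ m.2 := by
      have h := hdiv'.sub (Dvd.intro (a * u) (by rw [hu]; ring) : (n : ℤ) ∣ a * m.1)
      rwa [add_sub_cancel_left] at h
    have hm' : (c : ℤ) ∣ a * u + v := by
      have h : ((n : ℤ) * c) ∣ (n : ℤ) * (a * u + v) := by
        have e : (n : ℤ) * (a * u + v) = a * m.1 + m.2 := by rw [hu, hv]; ring
        have eN : ((n : ℤ) * c) = (N : ℤ) := by rw [hN]; push_cast; ring
        rw [e, eN]; exact hdiv
      exact (mul_dvd_mul_iff_left hn0).1 h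
    have hl' : l1 (u, v) ≤ 2 * t := by
      have e : l1 m = n * l1 (u, v) := by
        simp only [l1, hu, hv, Int.natAbs_mul, Int.natAbs_natCast]; ring
      rw [e] at hlt
      by_contra hgt
      rw [not_le] at hgt
      have : n * (2 * t + 1) ≤ n * l1 (u, v) := Nat.mul_le_mul_left n hgt
      omega
    have huv := rotated_core t hc ha ha' (m := (u, v)) hm' hl'
    simp only [Prod.ext_iff, Prod.fst_zero, Prod.snd_zero] at huv
    apply h0
    ext
    · rw [hu, huv.1, mul_zero]; rfl
    · rw [hv, huv.2, mul_zero]; rfl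

/-- **Kovalev–Pryadko 2013 Example 7 as a theorem for every `n ≥ 1`, `t`**: with `N = nc`, `c = t² + (t+1)²` and `a`
as above, the twisted toric code `LP[1 + x y^a, 1 + y]` over `ℤ_n × ℤ_N` (period lattice `nΛ_t`) is
`[[2n²c, 2, n(2t+1)]]` (stated with `2·|ℤ_n × ℤ_N| = 2nN`).
[cite: KovalevPryadko2013Hyperbicycle, §IV Ex. 7 (p0016 L18-24: «c = t²+(t+1)², χ = 2t+1 … By construction in Eq. (19) we obtain codes with parameters [[2n²c, 2, nχ]]»)] -/
theorem dilated_isCode (hN : N = n * c) (hc : (c : ℤ) = (t : ℤ) ^ 2 + ((t : ℤ) + 1) ^ 2)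
    (ha : (c : ℤ) ∣ ((t : ℤ) + 1) * a - t) (ha' : (c : ℤ) ∣ (t : ℤ) * a + (t + 1)) :
    (code ((1 : ZMod n), (a : ZMod N)) ((0 : ZMod n), (1 : ZMod N))).IsCode (2 * (n * N)) 2 (n * (2 * t + 1)) := by
  have h := code_isCode_of_gen (gen_dilated (n := n) (N := N) a)
  rwa [systole_dilated hN hc ha ha', Fintype.card_prod, ZMod.card, ZMod.card] at h

/-- `(n,t) = (2,1)`: `[[40, 2, 6]]` — `LP[1 + x y³, 1 + y]` over `ℤ₂ × ℤ₁₀` (KP13 Ex. 7 «for n=2 we obtain [[40,2,6]]»; census row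
HB40 up to the automorphism `y ↦ −y`, lit/TWIST-LOCATORS.md §4). [cite: KovalevPryadko2013Hyperbicycle, §IV Ex. 7 (p0016 L22-23: [[40,2,6]])] -/
theorem dilated_isCode_40 : (code ((1, 3) : ZMod 2 × ZMod 10) (0, 1)).IsCode 40 2 6 := by
  have h := dilated_isCode (n := 2) (N := 10) (c := 5) (t := 1) (a := 3) (by norm_num) (by norm_num) (by decide)
    (by decide)
  simpa using h

/-- `(n,t) = (3,1)`: `[[90, 2, 9]]` — `LP[1 + x y³, 1 + y]` over `ℤ₃ × ℤ₁₅` (KP13 Ex. 7 «for n=3 [[90,2,9]]»; census row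
HB90a, FINDINGS CR-5, up to `y ↦ −y`). [cite: KovalevPryadko2013Hyperbicycle, §IV Ex. 7 (p0016 L23-24: [[90,2,9]])] -/
theorem dilated_isCode_90 : (code ((1, 3) : ZMod 3 × ZMod 15) (0, 1)).IsCode 90 2 9 := by
  have h := dilated_isCode (n := 3) (N := 15) (c := 5) (t := 1) (a := 3) (by norm_num) (by norm_num) (by decide)
    (by decide)
  simpa using h

/-- `(n,t) = (2,2)`: `[[104, 2, 10]]` — `LP[1 + x y⁵, 1 + y]` over `ℤ₂ × ℤ₂₆` (KP13 Ex. 7 «[[104,2,10]]»; literally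
qec-lit-3's presentation of census row HB104). [cite: KovalevPryadko2013Hyperbicycle, §IV Ex. 7 (p0016 L22-23: [[104,2,10]])] -/
theorem dilated_isCode_104 : (code ((1, 5) : ZMod 2 × ZMod 26) (0, 1)).IsCode 104 2 10 := by
  have h := dilated_isCode (n := 2) (N := 26) (c := 13) (t := 2) (a := 5) (by norm_num) (by norm_num) (by decide)
    (by decide)
  simpa using h

/-- `(n,t) = (3,2)`: `[[234, 2, 15]]` — `LP[1 + x y⁵, 1 + y]` over `ℤ₃ × ℤ₃₉` (KP13 Ex. 7 «[[234,2,15]]»; no census row).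
[cite: KovalevPryadko2013Hyperbicycle, §IV Ex. 7 (p0016 L23-24: [[234,2,15]])] -/
theorem dilated_isCode_234 : (code ((1, 5) : ZMod 3 × ZMod 39) (0, 1)).IsCode 234 2 15 := by
  have h := dilated_isCode (n := 3) (N := 39) (c := 13) (t := 2) (a := 5) (by norm_num) (by norm_num) (by decide)
    (by decide)
  simpa using h

end Dilated

end TwistedToric

end Literature.InformationTheory.QuantumCodes
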